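import Mathlib
import Summits.ResolutionOfSingularities.ResolutionOfSingularities.Theorems.SyzygyFlatteningDefs
import Literature.AlgebraicGeometry.Resolution.TranscendenceDefect
import HarnessLib

/-!
# Syzygy-flattening tower: a generic radius for the Gauss extension

Stub `stub_genericRadius` of the crux `HigherRankTermination` (line `birth`, base-change line).
To base-change `(k, K) ↦ (k(X), K(X))` along a Gauss extension `w(∑ aᵢ (X - ζ)ⁱ) = maxᵢ v(aᵢ) cⁱ`
of a real-valued valuation `v` of `K` with valuation ring `O ⊇ k` WITHOUT enlarging the residue
field, the radius `c ∈ (0, 1)` must be *generic*: no positive power `c ^ m` is a value `v a`.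
Such a radius exists as soon as `tr.deg_k K < ℵ₀`:

* by Abhyankar's inequality the value group `Γ_O = K^× / O^×` has finite rational rank
  (`Literature.AlgebraicGeometry.Resolution.ratRank_lt_aleph0`);
* a torsion-free abelian group of finite `ℤ`-rank is countable (a maximal `ℤ`-independent family
  `s` is finite, every element has a non-zero multiple in the countable group `span ℤ s`, and
  `g ↦ (n, n • g)` is injective by torsion-freeness) — `genericRadius_countable_of_rank_lt_aleph0`;
* hence `Set.range v` is countable (`v` is equivalent to `O.valuation`, whose target is
  `{0} ∪ Γ_O`), and so is the set of `c : ℝ≥0` some positive power of which is a value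
  (`x ↦ x ^ m` is injective on `ℝ≥0` for `m ≥ 1`), while `(0, 1) ⊆ ℝ≥0` is uncountable.

Sources: Temkin 2013 §2.1 (the invariants `E`, `F`); Kuhlmann 2010 Lemma 2.5 (value-transcendental
Gauss extensions); the countability argument is folklore.
-/

noncomputable section

-- single-problem summit: the doubled namespace component is forced
set_option linter.dupNamespace false

open scoped NNReal

namespace Summit.ResolutionOfSingularities.ResolutionOfSingularities.Theorems.SyzygyFlattening

open Literature.AlgebraicGeometry.Resolution

/-- A torsion-free abelian group of finite `ℤ`-rank is countable. [folklore] -/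
theorem genericRadius_countable_of_rank_lt_aleph0 (M : Type*) [AddCommGroup M]
    [IsAddTorsionFree M] (h : Module.rank ℤ M < Cardinal.aleph0) : Countable M := by
  classical
  obtain ⟨s, hs, hmax⟩ := exists_maximal_linearIndepOn ℤ (id : M → M)
  -- a `ℤ`-independent set is finite
  have hsfin : s.Finite := by
    rw [← Cardinal.lt_aleph0_iff_set_finite]
    exact (hs.linearIndependent.cardinal_le_rank).trans_lt h
  haveI : Finite s := hsfin.to_subtype
  -- every element has a non-zero multiple in `span ℤ s`
  have key : ∀ x : M, ∃ a : ℤ, a ≠ 0 ∧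
      a • x ∈ Submodule.span ℤ (Set.range (Subtype.val : s → M)) := by
    intro x
    rw [Subtype.range_coe]
    by_cases hx : x ∈ s
    · exact ⟨1, one_ne_zero, by rw [one_smul]; exact Submodule.subset_span hx⟩
    · obtain ⟨a, ha, hax⟩ := hmax x hx
      exact ⟨a, ha, by simpa using hax⟩
  choose a ha hax using key
  have hinj : Function.Injective fun x : M =>
      (a x, (⟨a x • x, hax x⟩ : Submodule.span ℤ (Set.range (Subtype.val : s → M)))) := by
    intro x y hxy
    simp only [Prod.mk.injEq, Subtype.mk.injEq] at hxy
    obtain ⟨h1, h2⟩ := hxy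
    rw [h1] at h2
    exact zsmul_right_injective (ha y) h2
  exact hinj.countable

/-- The value group with zero of a valuation ring of finite rational rank is countable.
[folklore] -/
theorem genericRadius_countable_valueGroup {K : Type} [Field K] (O : ValuationSubring K)
    (h : ratRank O < Cardinal.aleph0) : Countable (ValuationSubring.ValueGroup O) := by
  have hu : Countable (Additive (ValuationSubring.ValueGroup O)ˣ) :=
    genericRadius_countable_of_rank_lt_aleph0 _ h
  have hu' : Countable (ValuationSubring.ValueGroup O)ˣ := hu
  rw [← Set.countable_univ_iff]
  refine ((Set.countable_singleton (0 : ValuationSubring.ValueGroup O)).union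
    (Set.countable_range
      (Units.val : (ValuationSubring.ValueGroup O)ˣ → ValuationSubring.ValueGroup O))).mono ?_
  intro γ _
  rcases eq_or_ne γ 0 with h0 | h0
  · exact Or.inl h0
  · exact Or.inr ⟨Units.mk0 γ h0, rfl⟩

/-- A real-valued valuation with valuation ring `O` takes countably many values as soon as the
value group of `O` is countable. [folklore] -/
theorem genericRadius_countable_range {K : Type} [Field K] (O : ValuationSubring K)
    [Countable (ValuationSubring.ValueGroup O)] (v : Valuation K ℝ≥0)
    (hv : ∀ x : K, v x ≤ 1 ↔ x ∈ O) : (Set.range v).Countable := by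
  have hequiv : v.IsEquiv O.valuation :=
    Valuation.isEquiv_iff_val_le_one.mpr fun {x} => by
      rw [hv x, ValuationSubring.valuation_le_one_iff]
  refine (Set.countable_range fun γ : ValuationSubring.ValueGroup O =>
    v (Function.surjInv O.valuation_surjective γ)).mono ?_
  rintro _ ⟨a, rfl⟩
  refine ⟨O.valuation a, ?_⟩
  exact hequiv.eq_iff.mpr (Function.surjInv_eq O.valuation_surjective (O.valuation a))

/-- The open unit interval of `ℝ≥0` is uncountable. [folklore] -/
theorem genericRadius_not_countable_Ioo : ¬ (Set.Ioo (0 : ℝ≥0) 1).Countable := by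
  intro h
  have h' : (Set.Ioo (0 : ℝ) 1).Countable := by
    refine (h.image ((↑) : ℝ≥0 → ℝ)).mono ?_
    intro x hx
    exact ⟨⟨x, hx.1.le⟩, ⟨hx.1, hx.2⟩, rfl⟩
  rw [Cardinal.Real.Ioo_countable_iff] at h'
  exact absurd h' (not_le.mpr one_pos)

/-- **Generic radius.** For a valuation ring `O ⊇ k` of `K` with `tr.deg_k K < ℵ₀` and a
real-valued valuation `v` of `K` with ring `O`, there is a radius `c ∈ (0, 1)` none of whose
positive powers is a value of `v` on `K^×` (the value group has finite rational rank by
Abhyankar's inequality, hence is countable, so the radii to avoid form a countable subset of the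
uncountable interval `(0, 1)`). [folklore] -/
theorem stub_genericRadius : ∀ (k K : Type) [Field k] [Field K] [Algebra k K]
    (O : ValuationSubring K), (∀ c : k, algebraMap k K c ∈ O) →
      Algebra.trdeg k K < Cardinal.aleph0 →
      ∀ v : Valuation K ℝ≥0, (∀ x : K, v x ≤ 1 ↔ x ∈ O) →
        ∃ c : ℝ≥0, 0 < c ∧ c < 1 ∧ ∀ m : ℕ, 0 < m → ∀ a : K, a ≠ 0 → v a ≠ c ^ m := by
  intro k K _ _ _ O hk hN v hv
  haveI : Countable (ValuationSubring.ValueGroup O) :=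
    genericRadius_countable_valueGroup O (ratRank_lt_aleph0 O hk hN)
  have hS : (Set.range v).Countable := genericRadius_countable_range O v hv
  -- the radii to avoid: some positive power is a value
  set B : Set ℝ≥0 := ⋃ m : ℕ, (fun c : ℝ≥0 => c ^ (m + 1)) ⁻¹' Set.range v with hB
  have hBc : B.Countable :=
    Set.countable_iUnion fun m => hS.preimage (pow_left_injective m.succ_ne_zero)
  obtain ⟨c, hc, hcB⟩ : ∃ c ∈ Set.Ioo (0 : ℝ≥0) 1, c ∉ B := by
    by_contra! hall
    exact genericRadius_not_countable_Ioo (hBc.mono hall)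
  refine ⟨c, hc.1, hc.2, fun m hm a _ hva => hcB ?_⟩
  rw [hB, Set.mem_iUnion]
  refine ⟨m - 1, ?_⟩
  rw [Set.mem_preimage, Nat.sub_add_cancel hm]
  exact ⟨a, hva⟩

end Summit.ResolutionOfSingularities.ResolutionOfSingularities.Theorems.SyzygyFlattening

end
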